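import Summits.CriticalPhenomena.PercolationContinuityZ3.Theorems.PercNearOneGluingNoHeavyLowerTailQuantitativeBHKVertexFunStrict
import HarnessLib

/-!
# The isolated Harris covariance and the conditioned vdBHK covariance have the same zero set

Support file (`--supports stmt-CriticalPhenomena-4575`), prover seat `prim-rate-mine-2` (lane prim-rate, constants-miner (c), BENCH row
M2-R46; `run/shared/lean/prim/prim-rate/prim-rate-mine-2/PROOFS.md` §P46).  No definitions, no named facts, no sorries; standard axioms.

Two slacks of block (A) compare a monotone vertex functional `F(C_x)` with a connection `{x ↔ o}` while the cluster of `x` avoids a set `X`: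
the CONDITIONED covariance `covD w x X F̂ o = μ(D)·∫_{D ∩ {x↔o}} F̂ − ∫_D F̂ · μ(D ∩ {x↔o})`, `D = {x ↮ X}` (vdBHK Thm 1.3: `≥ 0`), and the
ISOLATED covariance `Cov_{w_X}(F̂, 1{x ↔ o})` under the weights `w_X` zeroed on the pairs meeting `X` (Harris: `≥ 0`), which is the summand of
the explicit floors of rows M2-R21/30/41/45 (times `∏(1 − w)`).  They are different numbers, but

* `CSH.covD_clusterFun_pos_iff_isolated` — **`0 < covD w x X F̂ o ↔ 0 < Cov_{w_X}(F̂, 1{x ↔ o})`** (weights non-degenerate on their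
  support `E`, `x, o ∉ X`, `o ≠ x`, `F` monotone): both are positive iff a pair of `E` missing `X` is jointly pivotal inside the pairs of `E`
  missing `X` — row M2-R44 (`CSH.covD_clusterFun_pos_iff`) for `(w, X)` and for `(w_X, ∅)`, whose support is `E_X`.

So the isolated Harris minorant detects strictness of the conditioned inequality EXACTLY (it loses size, never the locus); with row M2-R46
(`CSH.exists_jointly_pivotal_of_separately`) the common locus is also Harris' separate-influence criterion on `E_X`.
[cite: VandenbergHaggstromKahn2005, Thm. 1.3 (p. 6)] [cite: Harris1960, Lemma 4.1 (p. 16)]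
-/

noncomputable section

namespace Summit.CriticalPhenomena.PercolationContinuityZ3.Theorems

open MeasureTheory Set Literature.Probability.LatticeModels Literature.Probability.Percolation
open scoped Classical
open KNPreFKG

namespace CSH

variable {n : ℕ}

/-- **Conditioned covariance positive ⟺ isolated covariance positive.**  Weights non-degenerate on their support `E`; `x, o ∉ X`, `o ≠ x`;
`F` monotone on vertex sets; `w_X` = `w` zeroed on the pairs meeting `X`.  Then `0 < covD w x X F̂ o` iff
`0 < ∫_{x↔o} F̂ dP_{w_X} − P_{w_X}(x ↔ o)·∫ F̂ dP_{w_X}` — both iff a pair of `E` missing `X` is jointly pivotal for `F(C_x)` and `{x ↔ o}`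
at a configuration inside the pairs of `E` missing `X`. [cite: VandenbergHaggstromKahn2005, Thm. 1.3 (p. 6)] [cite: Harris1960, Lemma 4.1 (p. 16)] -/
theorem covD_clusterFun_pos_iff_isolated (w : Sym2 (Fin n) → unitInterval) (E : Set (Sym2 (Fin n)))
    (hE0 : ∀ f, f ∉ E → (w f : ℝ) = 0) (hE1 : ∀ f ∈ E, 0 < (w f : ℝ) ∧ (w f : ℝ) < 1)
    (x : Fin n) (X : Set (Fin n)) (o : Fin n) (hxX : x ∉ X) (hox : o ≠ x) (hoX : o ∉ X)
    (F : Set (Fin n) → ℝ) (hF : ∀ S S' : Set (Fin n), S ⊆ S' → F S ≤ F S') :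
    0 < covD w x X (fun C => F {a | a = x ∨ ∃ e ∈ C, a ∈ e}) o ↔
      0 < (∫ η in openConn x o, F {c | c = x ∨ ∃ e ∈ openEdgeCluster η x, c ∈ e}
              ∂(prodBernoulli (fun e => if (∃ y ∈ X, y ∈ e) then (0 : unitInterval) else w e))) -
            (prodBernoulli (fun e => if (∃ y ∈ X, y ∈ e) then (0 : unitInterval) else w e)).real (openConn x o) *
              ∫ η, F {c | c = x ∨ ∃ e ∈ openEdgeCluster η x, c ∈ e}
                ∂(prodBernoulli (fun e => if (∃ y ∈ X, y ∈ e) then (0 : unitInterval) else w e)) := by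
  set wX : Sym2 (Fin n) → unitInterval := (fun e => if (∃ y ∈ X, y ∈ e) then (0 : unitInterval) else w e) with hwX
  set EX : Set (Sym2 (Fin n)) := {f | f ∈ E ∧ ∀ y ∈ X, y ∉ f} with hEX
  have hE0' : ∀ f, f ∉ EX → (wX f : ℝ) = 0 := by
    intro f hf
    simp only [hwX]
    split_ifs with h
    · rfl
    · exact hE0 f fun hfE => hf ⟨hfE, fun y hy hyf => h ⟨y, hy, hyf⟩⟩
  have hE1' : ∀ f ∈ EX, 0 < (wX f : ℝ) ∧ (wX f : ℝ) < 1 := by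
    intro f hf
    have h : ¬ ∃ y ∈ X, y ∈ f := fun ⟨y, hy, hyf⟩ => hf.2 y hy hyf
    simp only [hwX, if_neg h]
    exact hE1 f hf.1
  -- the isolated covariance is the conditioned covariance of `wX` at `X = ∅`
  have hiso : covD wX x (∅ : Set (Fin n)) (fun C => F {a | a = x ∨ ∃ e ∈ C, a ∈ e}) o =
      (∫ η in openConn x o, F {c | c = x ∨ ∃ e ∈ openEdgeCluster η x, c ∈ e} ∂(prodBernoulli wX)) -
        (prodBernoulli wX).real (openConn x o) * ∫ η, F {c | c = x ∨ ∃ e ∈ openEdgeCluster η x, c ∈ e} ∂(prodBernoulli wX) := by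
    have hD : {ω : BondConfig (Fin n) | ∀ y ∈ (∅ : Set (Fin n)), ¬ (openGraph ω).Reachable x y} = univ := by
      ext ω; simp
    rw [covD, hD, probReal_univ, one_mul, univ_inter, Measure.restrict_univ, mul_comm]
  rw [← hiso, covD_clusterFun_pos_iff w E hE0 hE1 x X o hxX hox hoX F hF,
    covD_clusterFun_pos_iff wX EX hE0' hE1' x ∅ o (Set.notMem_empty x) hox (Set.notMem_empty o) F hF]
  constructor
  · rintro ⟨e, he, heX, η, hη, hlt, h1, h0⟩
    exact ⟨e, ⟨he, heX⟩, fun y hy => hy.elim, η, fun f hf => ⟨hη hf, fun y hy => hy.elim⟩, hlt, h1, h0⟩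
  · rintro ⟨e, he, -, η, hη, hlt, h1, h0⟩
    exact ⟨e, he.1, he.2, η, fun f hf => (hη hf).1, hlt, h1, h0⟩

end CSH

end Summit.CriticalPhenomena.PercolationContinuityZ3.Theorems

end
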